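import Summits.CriticalPhenomena.PercolationContinuityZ3.Theorems.PercNearOneGluingNoHeavyQuantLongTailQuadHubAlg
import Summits.CriticalPhenomena.PercolationContinuityZ3.Theorems.PercNearOneGluingNoHeavyQuantLongTailQuadHubCert
import HarnessLib

/-!
# QUANT lane R8, T-DEC: ALGEBRA OF THE LONG-TAIL QUAD HUB IN `(lo, K)` UNITS — the six route capacities of the width-4 sub-floor hub
# `S(γ₁) ∗ S(γ₂) ∗ S(γ₃) ∗ S(γ₄)` of shape `{lo, lo+K; γ}`, `2lo ≤ K ≤ 4lo`, as used by the route file (census-1 gen 35)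

builds on p205010 (kernel theorem, internal audit signed; external expert review pending)

Support file (`--supports stmt-CriticalPhenomena-4575`), QUANT lane seat prim-quant-census-1 (gen 35); memo
`run/shared/lean/prim/quant/prim-quant-census-1/g35/QUADHUB-G35.md`.  Theorems only, standard axioms, no sorries.  The closed forms of
`…QuantLongTailQuadHubAlg` (`quadHub_capA/capB/coreE/coreF`, by hand) and `…QuantLongTailQuadHubCert` (`quadHub_coreC/coreD`, certificates) live in
K-units (`c = lo/K`, `d = D/K`, `D = T − 8lo` the credit of the gated mean); here they are transported to the variables of the route file
(`lo, K, D`, gates `gᵢ` with `lo ≤ Kgᵢ`, masses `u₀..u₃` of the atoms `4lo + sK`) and the worst-credit cores are extended to every credit of their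
regime by monotonicity in `d`:
* `quadHub_masses_nonneg`; `quadHub_capAx` — `x(u₀+u₂) ≤ u₂` for `x(lo+K) ≤ lo + Kγ_min`; `quadHub_capBK` — `D·u₀ ≤ (2K−D)u₂` (`0 ≤ D ≤ K`);
* `quadHub_capCK` — `(D+8lo)(u₀+u₃) ≤ 4(lo+K)u₃` and `quadHub_capDK` — `D·u₀ ≤ (3K−D)u₃` (`K ≤ D ≤ KΛ − 4lo`);
* `quadHub_capEK` — `(D+8lo)(u₁+u₂) ≤ 4(lo+K)u₂` and `quadHub_capFK` — `(D−2K)u₁ ≤ (3K−D)u₂` (`2K ≤ D ≤ KΛ − 4lo`).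
(The floor forms are used with the crude bound `4y(lo+K) ≤ T = 8lo + D`, from `x(lo+K) ≤ lo + Kγᵢ` summed over the four gates.)

HONEST STATUS.  Algebra only; `SiblingStep`, `GluedDominatedMass`, `SDECConvClosed`, `FarTreeRow` OPEN; RATE class (log\*) / honest sentence of
`run/shared/lean/prim/quant/README.md` unchanged.  [this work].  Nothing here is cited as a published result.  The gluing rows served
[cite: KozmaNitzan2024, Conjecture 3 (p. 15)]; product measure [cite: Grimmett1999, §1.3 p. 10].
-/

noncomputable section

namespace Summit.CriticalPhenomena.PercolationContinuityZ3.Theorems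
namespace Quant
namespace LawDec

/-! ### The capacities in `(lo, K)` units (`c = lo/K`, `d = D/K`) -/

/-- masses are nonnegative for gates in `[0,1]` (helper). [this work] -/
theorem quadHub_masses_nonneg (g₁ g₂ g₃ g₄ : ℝ) (h1 : 0 ≤ g₁) (h2 : 0 ≤ g₂) (h3 : 0 ≤ g₃) (h4 : 0 ≤ g₄)
    (h11 : g₁ ≤ 1) (h21 : g₂ ≤ 1) (h31 : g₃ ≤ 1) (h41 : g₄ ≤ 1) :
    0 ≤ (1 - g₁) * (1 - g₂) * (1 - g₃) * (1 - g₄) ∧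
    0 ≤ g₁ * (1 - g₂) * (1 - g₃) * (1 - g₄) + g₂ * (1 - g₁) * (1 - g₃) * (1 - g₄)
        + g₃ * (1 - g₁) * (1 - g₂) * (1 - g₄) + g₄ * (1 - g₁) * (1 - g₂) * (1 - g₃) ∧
    0 ≤ g₁ * g₂ * (1 - g₃) * (1 - g₄) + g₁ * g₃ * (1 - g₂) * (1 - g₄) + g₁ * g₄ * (1 - g₂) * (1 - g₃)
        + g₂ * g₃ * (1 - g₁) * (1 - g₄) + g₂ * g₄ * (1 - g₁) * (1 - g₃) + g₃ * g₄ * (1 - g₁) * (1 - g₂) ∧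
    0 ≤ g₂ * g₃ * g₄ * (1 - g₁) + g₁ * g₃ * g₄ * (1 - g₂) + g₁ * g₂ * g₄ * (1 - g₃) + g₁ * g₂ * g₃ * (1 - g₄) := by
  have e1 := sub_nonneg.2 h11; have e2 := sub_nonneg.2 h21; have e3 := sub_nonneg.2 h31; have e4 := sub_nonneg.2 h41
  exact ⟨by positivity, by positivity, by positivity, by positivity⟩

/-- **(A) in `(lo,K)` units**: `x·(u₀+u₂) ≤ u₂` for the least gate `g₁ ≥ lo/K` and every floor `x(lo+K) ≤ lo + Kg₁` (`2lo ≤ K ≤ 4lo`). [this work] -/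
theorem quadHub_capAx (lo K g₁ g₂ g₃ g₄ x : ℝ) (hlo : 0 < lo) (hK2 : 2 * lo ≤ K) (hK8 : K ≤ 4 * lo) (hg : lo ≤ K * g₁)
    (h12 : g₁ ≤ g₂) (h13 : g₁ ≤ g₃) (h14 : g₁ ≤ g₄) (h21 : g₂ ≤ 1) (h31 : g₃ ≤ 1) (h41 : g₄ ≤ 1) (hx : x * (lo + K) ≤ lo + K * g₁) :
    x * ((1 - g₁) * (1 - g₂) * (1 - g₃) * (1 - g₄)
        + (g₁ * g₂ * (1 - g₃) * (1 - g₄) + g₁ * g₃ * (1 - g₂) * (1 - g₄) + g₁ * g₄ * (1 - g₂) * (1 - g₃)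
          + g₂ * g₃ * (1 - g₁) * (1 - g₄) + g₂ * g₄ * (1 - g₁) * (1 - g₃) + g₃ * g₄ * (1 - g₁) * (1 - g₂)))
      ≤ g₁ * g₂ * (1 - g₃) * (1 - g₄) + g₁ * g₃ * (1 - g₂) * (1 - g₄) + g₁ * g₄ * (1 - g₂) * (1 - g₃)
          + g₂ * g₃ * (1 - g₁) * (1 - g₄) + g₂ * g₄ * (1 - g₁) * (1 - g₃) + g₃ * g₄ * (1 - g₁) * (1 - g₂) := by
  have hK : 0 < K := by linarith
  set c : ℝ := lo / K with hc
  have hcK : c * K = lo := by rw [hc]; field_simp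
  have hc4 : 1 / 4 ≤ c := by rw [hc, le_div_iff₀ hK]; linarith
  have h1 : c ≤ g₁ := by rw [hc, div_le_iff₀ hK]; linarith
  have hA := quadHub_capA g₁ g₂ g₃ g₄ c hc4 h1 h12 h13 h14 h21 h31 h41
  have hg1 : 0 ≤ g₁ := le_trans (by rw [hc]; positivity) h1
  obtain ⟨n0, -, n2, -⟩ := quadHub_masses_nonneg g₁ g₂ g₃ g₄ hg1 (by linarith) (by linarith) (by linarith) (by linarith) h21 h31 h41
  set U0 := (1 - g₁) * (1 - g₂) * (1 - g₃) * (1 - g₄) with hU0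
  set U2 := g₁ * g₂ * (1 - g₃) * (1 - g₄) + g₁ * g₃ * (1 - g₂) * (1 - g₄) + g₁ * g₄ * (1 - g₂) * (1 - g₃)
          + g₂ * g₃ * (1 - g₁) * (1 - g₄) + g₂ * g₄ * (1 - g₁) * (1 - g₃) + g₃ * g₄ * (1 - g₁) * (1 - g₂) with hU2
  clear_value c U0 U2
  -- `K·(c+g₁) = lo + Kg₁`, `K·(1+c) = lo + K`
  have hAK : (lo + K * g₁) * (U0 + U2) ≤ (lo + K) * U2 := by
    have := mul_le_mul_of_nonneg_left hA hK.le
    have e1 : K * ((c + g₁) * (U0 + U2)) = (lo + K * g₁) * (U0 + U2) := by rw [← hcK]; ring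
    have e2 : K * ((1 + c) * U2) = (lo + K) * U2 := by rw [← hcK]; ring
    linarith [e1, e2]
  have h2 : x * (lo + K) * (U0 + U2) ≤ (lo + K * g₁) * (U0 + U2) := mul_le_mul_of_nonneg_right hx (add_nonneg n0 n2)
  have h3 : (lo + K) * (x * (U0 + U2)) ≤ (lo + K) * U2 := by linarith
  exact le_of_mul_le_mul_left h3 (by linarith)

/-- **(B) in `(lo,K)` units**: `D·u₀ ≤ (2K − D)·u₂` for `0 ≤ D ≤ K`, `D ≤ K·Λ − 4lo` (`2lo ≤ K ≤ 4lo`, gates `≥ lo/K`). [this work] -/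
theorem quadHub_capBK (lo K g₁ g₂ g₃ g₄ D : ℝ) (hlo : 0 < lo) (hK2 : 2 * lo ≤ K) (hK8 : K ≤ 4 * lo)
    (hg₁ : lo ≤ K * g₁) (hg₂ : lo ≤ K * g₂) (hg₃ : lo ≤ K * g₃) (hg₄ : lo ≤ K * g₄) (h11 : g₁ ≤ 1) (h21 : g₂ ≤ 1) (h31 : g₃ ≤ 1) (h41 : g₄ ≤ 1)
    (hD0 : 0 ≤ D) (hD1 : D ≤ K) (hDS : D ≤ K * (g₁ + g₂ + g₃ + g₄) - 4 * lo) :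
    D * ((1 - g₁) * (1 - g₂) * (1 - g₃) * (1 - g₄))
      ≤ (2 * K - D) * (g₁ * g₂ * (1 - g₃) * (1 - g₄) + g₁ * g₃ * (1 - g₂) * (1 - g₄) + g₁ * g₄ * (1 - g₂) * (1 - g₃)
          + g₂ * g₃ * (1 - g₁) * (1 - g₄) + g₂ * g₄ * (1 - g₁) * (1 - g₃) + g₃ * g₄ * (1 - g₁) * (1 - g₂)) := by
  have hK : 0 < K := by linarith
  set c : ℝ := lo / K with hc
  set d : ℝ := D / K with hd
  have hcK : c * K = lo := by rw [hc]; field_simp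
  have hdK : d * K = D := by rw [hd]; field_simp
  have hc4 : 1 / 4 ≤ c := by rw [hc, le_div_iff₀ hK]; linarith
  have h1 : c ≤ g₁ := by rw [hc, div_le_iff₀ hK]; linarith
  have h2 : c ≤ g₂ := by rw [hc, div_le_iff₀ hK]; linarith
  have h3 : c ≤ g₃ := by rw [hc, div_le_iff₀ hK]; linarith
  have h4 : c ≤ g₄ := by rw [hc, div_le_iff₀ hK]; linarith
  have hd0 : 0 ≤ d := by rw [hd]; positivity
  have hd1 : d ≤ 1 := by rw [hd, div_le_iff₀ hK]; linarith
  have hdS : d ≤ g₁ + g₂ + g₃ + g₄ - 4 * c := by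
    rw [hd, hc, div_le_iff₀ hK]
    have : (g₁ + g₂ + g₃ + g₄ - 4 * (lo / K)) * K = K * (g₁ + g₂ + g₃ + g₄) - 4 * lo := by field_simp
    rw [this]; exact hDS
  have hB := quadHub_capB g₁ g₂ g₃ g₄ c d hc4 h1 h2 h3 h4 h11 h21 h31 h41 hd0 hd1 hdS
  set U0 := (1 - g₁) * (1 - g₂) * (1 - g₃) * (1 - g₄) with hU0
  set U2 := g₁ * g₂ * (1 - g₃) * (1 - g₄) + g₁ * g₃ * (1 - g₂) * (1 - g₄) + g₁ * g₄ * (1 - g₂) * (1 - g₃)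
          + g₂ * g₃ * (1 - g₁) * (1 - g₄) + g₂ * g₄ * (1 - g₁) * (1 - g₃) + g₃ * g₄ * (1 - g₁) * (1 - g₂) with hU2
  clear_value c d U0 U2
  have := mul_le_mul_of_nonneg_left hB hK.le
  have e1 : K * (d * U0) = D * U0 := by rw [← hdK]; ring
  have e2 : K * ((2 - d) * U2) = (2 * K - D) * U2 := by rw [← hdK]; ring
  linarith [e1, e2]

/-- **(C) in `(lo,K)` units — floor capacity of the route `4lo → 4lo+3K`**: `(D + 8lo)(u₀+u₃) ≤ 4(lo+K)·u₃` for `K ≤ D ≤ K·Λ − 4lo`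
(with `4y(lo+K) ≤ T = 8lo + D` this is `y(u₀+u₃) ≤ u₃`). [this work] -/
theorem quadHub_capCK (lo K g₁ g₂ g₃ g₄ D : ℝ) (hlo : 0 < lo) (hK2 : 2 * lo ≤ K) (hK8 : K ≤ 4 * lo)
    (hg₁ : lo ≤ K * g₁) (hg₂ : lo ≤ K * g₂) (hg₃ : lo ≤ K * g₃) (hg₄ : lo ≤ K * g₄) (h11 : g₁ ≤ 1) (h21 : g₂ ≤ 1) (h31 : g₃ ≤ 1) (h41 : g₄ ≤ 1)
    (hD1 : K ≤ D) (hDS : D ≤ K * (g₁ + g₂ + g₃ + g₄) - 4 * lo) :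
    (D + 8 * lo) * ((1 - g₁) * (1 - g₂) * (1 - g₃) * (1 - g₄)
        + (g₂ * g₃ * g₄ * (1 - g₁) + g₁ * g₃ * g₄ * (1 - g₂) + g₁ * g₂ * g₄ * (1 - g₃) + g₁ * g₂ * g₃ * (1 - g₄)))
      ≤ 4 * (lo + K) * (g₂ * g₃ * g₄ * (1 - g₁) + g₁ * g₃ * g₄ * (1 - g₂) + g₁ * g₂ * g₄ * (1 - g₃) + g₁ * g₂ * g₃ * (1 - g₄)) := by
  have hK : 0 < K := by linarith
  set c : ℝ := lo / K with hc
  have hcK : c * K = lo := by rw [hc]; field_simp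
  have hc4 : 1 / 4 ≤ c := by rw [hc, le_div_iff₀ hK]; linarith
  have h1 : c ≤ g₁ := by rw [hc, div_le_iff₀ hK]; linarith
  have h2 : c ≤ g₂ := by rw [hc, div_le_iff₀ hK]; linarith
  have h3 : c ≤ g₃ := by rw [hc, div_le_iff₀ hK]; linarith
  have h4 : c ≤ g₄ := by rw [hc, div_le_iff₀ hK]; linarith
  have hS : 4 * c + 1 ≤ g₁ + g₂ + g₃ + g₄ := by
    have h' : 4 * lo + K ≤ K * (g₁ + g₂ + g₃ + g₄) := by linarith
    have : (4 * c + 1) * K ≤ (g₁ + g₂ + g₃ + g₄) * K := by nlinarith [hcK]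
    exact le_of_mul_le_mul_right this hK
  have hC := quadHub_coreC g₁ g₂ g₃ g₄ c hc4 h1 h2 h3 h4 h11 h21 h31 h41 hS
  have hg1 : 0 ≤ g₁ := le_trans (by rw [hc]; positivity) h1
  have hg2 : 0 ≤ g₂ := le_trans (by rw [hc]; positivity) h2
  have hg3 : 0 ≤ g₃ := le_trans (by rw [hc]; positivity) h3
  have hg4 : 0 ≤ g₄ := le_trans (by rw [hc]; positivity) h4
  obtain ⟨n0, -, -, n3⟩ := quadHub_masses_nonneg g₁ g₂ g₃ g₄ hg1 hg2 hg3 hg4 h11 h21 h31 h41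
  set U0 := (1 - g₁) * (1 - g₂) * (1 - g₃) * (1 - g₄) with hU0
  set U3 := g₂ * g₃ * g₄ * (1 - g₁) + g₁ * g₃ * g₄ * (1 - g₂) + g₁ * g₂ * g₄ * (1 - g₃) + g₁ * g₂ * g₃ * (1 - g₄) with hU3
  clear_value c U0 U3
  -- `D + 8lo ≤ K(Λ + 4c)` and `K·[(Λ+4c)U0] ≤ K·[(4−Λ)U3]`
  have hDK : D + 8 * lo ≤ K * (g₁ + g₂ + g₃ + g₄ + 4 * c) := by nlinarith [hcK]
  have h5 := mul_le_mul_of_nonneg_right hDK (add_nonneg n0 n3)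
  have h6 := mul_le_mul_of_nonneg_left hC hK.le
  have e : 4 * (lo + K) * U3 = K * ((g₁ + g₂ + g₃ + g₄ + 4 * c) * U3) + K * ((4 - (g₁ + g₂ + g₃ + g₄)) * U3) := by
    rw [← hcK]; ring
  rw [e]; nlinarith [h5, h6]

/-- **(D) in `(lo,K)` units — credit capacity of the route `4lo → 4lo+3K`**: `D·u₀ ≤ (3K − D)·u₃` for `K ≤ D ≤ K·Λ − 4lo`. [this work] -/
theorem quadHub_capDK (lo K g₁ g₂ g₃ g₄ D : ℝ) (hlo : 0 < lo) (hK2 : 2 * lo ≤ K) (hK8 : K ≤ 4 * lo)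
    (hg₁ : lo ≤ K * g₁) (hg₂ : lo ≤ K * g₂) (hg₃ : lo ≤ K * g₃) (hg₄ : lo ≤ K * g₄) (h11 : g₁ ≤ 1) (h21 : g₂ ≤ 1) (h31 : g₃ ≤ 1) (h41 : g₄ ≤ 1)
    (hD1 : K ≤ D) (hDS : D ≤ K * (g₁ + g₂ + g₃ + g₄) - 4 * lo) :
    D * ((1 - g₁) * (1 - g₂) * (1 - g₃) * (1 - g₄))
      ≤ (3 * K - D) * (g₂ * g₃ * g₄ * (1 - g₁) + g₁ * g₃ * g₄ * (1 - g₂) + g₁ * g₂ * g₄ * (1 - g₃) + g₁ * g₂ * g₃ * (1 - g₄)) := by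
  have hK : 0 < K := by linarith
  set c : ℝ := lo / K with hc
  have hcK : c * K = lo := by rw [hc]; field_simp
  have hc4 : 1 / 4 ≤ c := by rw [hc, le_div_iff₀ hK]; linarith
  have h1 : c ≤ g₁ := by rw [hc, div_le_iff₀ hK]; linarith
  have h2 : c ≤ g₂ := by rw [hc, div_le_iff₀ hK]; linarith
  have h3 : c ≤ g₃ := by rw [hc, div_le_iff₀ hK]; linarith
  have h4 : c ≤ g₄ := by rw [hc, div_le_iff₀ hK]; linarith
  have hS : 4 * c + 1 ≤ g₁ + g₂ + g₃ + g₄ := by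
    have : (4 * c + 1) * K ≤ (g₁ + g₂ + g₃ + g₄) * K := by nlinarith [hcK]
    exact le_of_mul_le_mul_right this hK
  have hD := quadHub_coreD g₁ g₂ g₃ g₄ c hc4 h1 h2 h3 h4 h11 h21 h31 h41 hS
  have hg1 : 0 ≤ g₁ := le_trans (by rw [hc]; positivity) h1
  have hg2 : 0 ≤ g₂ := le_trans (by rw [hc]; positivity) h2
  have hg3 : 0 ≤ g₃ := le_trans (by rw [hc]; positivity) h3
  have hg4 : 0 ≤ g₄ := le_trans (by rw [hc]; positivity) h4
  obtain ⟨n0, -, -, n3⟩ := quadHub_masses_nonneg g₁ g₂ g₃ g₄ hg1 hg2 hg3 hg4 h11 h21 h31 h41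
  set U0 := (1 - g₁) * (1 - g₂) * (1 - g₃) * (1 - g₄) with hU0
  set U3 := g₂ * g₃ * g₄ * (1 - g₁) + g₁ * g₃ * g₄ * (1 - g₂) + g₁ * g₂ * g₄ * (1 - g₃) + g₁ * g₂ * g₃ * (1 - g₄) with hU3
  clear_value c U0 U3
  have hDK : D ≤ K * (g₁ + g₂ + g₃ + g₄ - 4 * c) := by nlinarith [hcK]
  have h5 := mul_le_mul_of_nonneg_right hDK n0
  have h6 := mul_le_mul_of_nonneg_left hD hK.le
  have h7 : (3 * K - K * (g₁ + g₂ + g₃ + g₄ - 4 * c)) * U3 ≤ (3 * K - D) * U3 := mul_le_mul_of_nonneg_right (by linarith) n3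
  nlinarith [h5, h6, h7]

/-- **(E) in `(lo,K)` units — floor capacity of the route `4lo+K → 4lo+2K`** (two-low regime `2K ≤ D ≤ K·Λ − 4lo`):
`(D + 8lo)(u₁+u₂) ≤ 4(lo+K)·u₂`. [this work] -/
theorem quadHub_capEK (lo K g₁ g₂ g₃ g₄ D : ℝ) (hlo : 0 < lo) (hK2 : 2 * lo ≤ K) (hK8 : K ≤ 4 * lo)
    (hg₁ : lo ≤ K * g₁) (hg₂ : lo ≤ K * g₂) (hg₃ : lo ≤ K * g₃) (hg₄ : lo ≤ K * g₄) (h11 : g₁ ≤ 1) (h21 : g₂ ≤ 1) (h31 : g₃ ≤ 1) (h41 : g₄ ≤ 1)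
    (hD2 : 2 * K ≤ D) (hDS : D ≤ K * (g₁ + g₂ + g₃ + g₄) - 4 * lo) :
    (D + 8 * lo) * ((g₁ * (1 - g₂) * (1 - g₃) * (1 - g₄) + g₂ * (1 - g₁) * (1 - g₃) * (1 - g₄)
        + g₃ * (1 - g₁) * (1 - g₂) * (1 - g₄) + g₄ * (1 - g₁) * (1 - g₂) * (1 - g₃))
        + (g₁ * g₂ * (1 - g₃) * (1 - g₄) + g₁ * g₃ * (1 - g₂) * (1 - g₄) + g₁ * g₄ * (1 - g₂) * (1 - g₃)
          + g₂ * g₃ * (1 - g₁) * (1 - g₄) + g₂ * g₄ * (1 - g₁) * (1 - g₃) + g₃ * g₄ * (1 - g₁) * (1 - g₂)))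
      ≤ 4 * (lo + K) * (g₁ * g₂ * (1 - g₃) * (1 - g₄) + g₁ * g₃ * (1 - g₂) * (1 - g₄) + g₁ * g₄ * (1 - g₂) * (1 - g₃)
          + g₂ * g₃ * (1 - g₁) * (1 - g₄) + g₂ * g₄ * (1 - g₁) * (1 - g₃) + g₃ * g₄ * (1 - g₁) * (1 - g₂)) := by
  have hK : 0 < K := by linarith
  set c : ℝ := lo / K with hc
  have hcK : c * K = lo := by rw [hc]; field_simp
  have hc4 : 1 / 4 ≤ c := by rw [hc, le_div_iff₀ hK]; linarith
  have h1 : c ≤ g₁ := by rw [hc, div_le_iff₀ hK]; linarith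
  have h2 : c ≤ g₂ := by rw [hc, div_le_iff₀ hK]; linarith
  have h3 : c ≤ g₃ := by rw [hc, div_le_iff₀ hK]; linarith
  have h4 : c ≤ g₄ := by rw [hc, div_le_iff₀ hK]; linarith
  have hS : 4 * c + 2 ≤ g₁ + g₂ + g₃ + g₄ := by
    have : (4 * c + 2) * K ≤ (g₁ + g₂ + g₃ + g₄) * K := by nlinarith [hcK]
    exact le_of_mul_le_mul_right this hK
  have hE := quadHub_coreE g₁ g₂ g₃ g₄ c hc4 h1 h2 h3 h4 h11 h21 h31 h41 hS
  have hg1 : 0 ≤ g₁ := le_trans (by rw [hc]; positivity) h1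
  have hg2 : 0 ≤ g₂ := le_trans (by rw [hc]; positivity) h2
  have hg3 : 0 ≤ g₃ := le_trans (by rw [hc]; positivity) h3
  have hg4 : 0 ≤ g₄ := le_trans (by rw [hc]; positivity) h4
  obtain ⟨-, n1, n2, -⟩ := quadHub_masses_nonneg g₁ g₂ g₃ g₄ hg1 hg2 hg3 hg4 h11 h21 h31 h41
  set U1 := g₁ * (1 - g₂) * (1 - g₃) * (1 - g₄) + g₂ * (1 - g₁) * (1 - g₃) * (1 - g₄)
        + g₃ * (1 - g₁) * (1 - g₂) * (1 - g₄) + g₄ * (1 - g₁) * (1 - g₂) * (1 - g₃) with hU1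
  set U2 := g₁ * g₂ * (1 - g₃) * (1 - g₄) + g₁ * g₃ * (1 - g₂) * (1 - g₄) + g₁ * g₄ * (1 - g₂) * (1 - g₃)
          + g₂ * g₃ * (1 - g₁) * (1 - g₄) + g₂ * g₄ * (1 - g₁) * (1 - g₃) + g₃ * g₄ * (1 - g₁) * (1 - g₂) with hU2
  clear_value c U1 U2
  have hDK : D + 8 * lo ≤ K * (g₁ + g₂ + g₃ + g₄ + 4 * c) := by nlinarith [hcK]
  have h5 := mul_le_mul_of_nonneg_right hDK (add_nonneg n1 n2)
  have h6 := mul_le_mul_of_nonneg_left hE hK.le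
  have e : 4 * (lo + K) * U2 = K * ((g₁ + g₂ + g₃ + g₄ + 4 * c) * U2) + K * ((4 - (g₁ + g₂ + g₃ + g₄)) * U2) := by
    rw [← hcK]; ring
  rw [e]; nlinarith [h5, h6]

/-- **(F) in `(lo,K)` units — credit capacity of the route `4lo+K → 4lo+2K`** (`2K ≤ D ≤ K·Λ − 4lo`): `(D − 2K)·u₁ ≤ (3K − D)·u₂`. [this work] -/
theorem quadHub_capFK (lo K g₁ g₂ g₃ g₄ D : ℝ) (hlo : 0 < lo) (hK2 : 2 * lo ≤ K) (hK8 : K ≤ 4 * lo)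
    (hg₁ : lo ≤ K * g₁) (hg₂ : lo ≤ K * g₂) (hg₃ : lo ≤ K * g₃) (hg₄ : lo ≤ K * g₄) (h11 : g₁ ≤ 1) (h21 : g₂ ≤ 1) (h31 : g₃ ≤ 1) (h41 : g₄ ≤ 1)
    (hD2 : 2 * K ≤ D) (hDS : D ≤ K * (g₁ + g₂ + g₃ + g₄) - 4 * lo) :
    (D - 2 * K) * (g₁ * (1 - g₂) * (1 - g₃) * (1 - g₄) + g₂ * (1 - g₁) * (1 - g₃) * (1 - g₄)
        + g₃ * (1 - g₁) * (1 - g₂) * (1 - g₄) + g₄ * (1 - g₁) * (1 - g₂) * (1 - g₃))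
      ≤ (3 * K - D) * (g₁ * g₂ * (1 - g₃) * (1 - g₄) + g₁ * g₃ * (1 - g₂) * (1 - g₄) + g₁ * g₄ * (1 - g₂) * (1 - g₃)
          + g₂ * g₃ * (1 - g₁) * (1 - g₄) + g₂ * g₄ * (1 - g₁) * (1 - g₃) + g₃ * g₄ * (1 - g₁) * (1 - g₂)) := by
  have hK : 0 < K := by linarith
  set c : ℝ := lo / K with hc
  have hcK : c * K = lo := by rw [hc]; field_simp
  have hc4 : 1 / 4 ≤ c := by rw [hc, le_div_iff₀ hK]; linarith
  have h1 : c ≤ g₁ := by rw [hc, div_le_iff₀ hK]; linarith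
  have h2 : c ≤ g₂ := by rw [hc, div_le_iff₀ hK]; linarith
  have h3 : c ≤ g₃ := by rw [hc, div_le_iff₀ hK]; linarith
  have h4 : c ≤ g₄ := by rw [hc, div_le_iff₀ hK]; linarith
  have hS : 4 * c + 2 ≤ g₁ + g₂ + g₃ + g₄ := by
    have : (4 * c + 2) * K ≤ (g₁ + g₂ + g₃ + g₄) * K := by nlinarith [hcK]
    exact le_of_mul_le_mul_right this hK
  have hF := quadHub_coreF g₁ g₂ g₃ g₄ c hc4 h1 h2 h3 h4 h11 h21 h31 h41 hS
  have hg1 : 0 ≤ g₁ := le_trans (by rw [hc]; positivity) h1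
  have hg2 : 0 ≤ g₂ := le_trans (by rw [hc]; positivity) h2
  have hg3 : 0 ≤ g₃ := le_trans (by rw [hc]; positivity) h3
  have hg4 : 0 ≤ g₄ := le_trans (by rw [hc]; positivity) h4
  obtain ⟨-, n1, n2, -⟩ := quadHub_masses_nonneg g₁ g₂ g₃ g₄ hg1 hg2 hg3 hg4 h11 h21 h31 h41
  set U1 := g₁ * (1 - g₂) * (1 - g₃) * (1 - g₄) + g₂ * (1 - g₁) * (1 - g₃) * (1 - g₄)
        + g₃ * (1 - g₁) * (1 - g₂) * (1 - g₄) + g₄ * (1 - g₁) * (1 - g₂) * (1 - g₃) with hU1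
  set U2 := g₁ * g₂ * (1 - g₃) * (1 - g₄) + g₁ * g₃ * (1 - g₂) * (1 - g₄) + g₁ * g₄ * (1 - g₂) * (1 - g₃)
          + g₂ * g₃ * (1 - g₁) * (1 - g₄) + g₂ * g₄ * (1 - g₁) * (1 - g₃) + g₃ * g₄ * (1 - g₁) * (1 - g₂) with hU2
  clear_value c U1 U2
  have hDK : D - 2 * K ≤ K * (g₁ + g₂ + g₃ + g₄ - 4 * c - 2) := by nlinarith [hcK]
  have h5 := mul_le_mul_of_nonneg_right hDK n1
  have h6 := mul_le_mul_of_nonneg_left hF hK.le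
  have h7 : (3 * K - K * (g₁ + g₂ + g₃ + g₄ - 4 * c)) * U2 ≤ (3 * K - D) * U2 := mul_le_mul_of_nonneg_right (by linarith) n2
  nlinarith [h5, h6, h7]

end LawDec
end Quant
end Summit.CriticalPhenomena.PercolationContinuityZ3.Theorems
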